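import Summits.RiemannHypothesis.RiemannHypothesis.Theorems.GroundBartaEvenWinsBeyondArchDeflationCertBridge
import HarnessLib

/-!
# RiemannHypothesis / GroundBarta — rung 4 (`EvenWinsBeyondArch`, stmt-RiemannHypothesis-18807 / 18085):
# the LEAKY CERTIFICATE — rank-one penalties against trial vectors cut inside the test window

Helper file (`--supports stmt-RiemannHypothesis-18085`), RH-free, no definitions, no named facts.  Prover B (gen 6 of
unit `sr-gb-rung-b`).

The rank-one augmented two-prime certificates prove, for test functions `φ` on `[-a₀, a₀]`,
`β‖φ‖² ≤ E₂₃(φ) + Σ_r μ_r |⟨φ, p_r⟩|²` with the FULL penalty polynomials `p_r = maskPoly r n a₀`.  The deflated Temple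
bridges (`…DeflationCertBridge{,W,WEven}`) rewrite `⟨φ, p_r⟩ = ⟨φ, 𝟙_{[-c,c]} p_r⟩` for `supp φ ⊆ [-c, c]`
(`dt_rankOne_term_eq`), so that the penalties are pairings with the TRIAL VECTORS — provided the vectors are cut
exactly at the test window.  In the ENDPOINT CELL `a* = (log 5)/2` the test window `c = a*` is irrational and the
trial vectors are `v_r = 𝟙_{[-c',c']} p_r` with a rational `c' < c`, so `⟨φ, p_r⟩ = ⟨φ, v_r⟩ + ⟨φ, 𝟙_S p_r⟩` with the
shell `S = [-c, c] ∖ [-c', c']` LEAKS.  By Cauchy–Schwarz and `|a + b|² ≤ 2|a|² + 2|b|²`: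

  `(β − 2ν)‖φ‖² ≤ E₂₃(φ) + Σ_r 2μ_r |⟨φ, v_r⟩|²`,   `ν ≥ Σ_r μ_r ∫_{[-a₀,a₀] ∖ [-c',c']} p_r²`

(`dt_cert_leak`): the certificate shape of the bridges with level `β − 2ν` and weights `2μ_r`, the leak `ν` being a
finite datum at rational endpoints.

* `dt_integral_norm_sq_indicator_sub` — `∫‖𝟙_{[-c,c]}p − 𝟙_{[-c',c']}p‖² = ∫_{[-c,c]∖[-c',c']} p²`;
* **`dt_cert_leak`**.
-/

set_option linter.dupNamespace false

noncomputable section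

open MeasureTheory Set Filter
open scoped Topology ComplexConjugate BigOperators

namespace Summit.RiemannHypothesis.RiemannHypothesis.Theorems.EvenWinsBeyondArch

open Literature.NumberTheory.LFunctions Literature.NumberTheory.LFunctions.ConnesVanSuijlekom
open Summit.RiemannHypothesis.RiemannHypothesis.Theorems.GroundStateSimpleEven (incs_memLp)

/-- **The shell piece of a cut profile**: for `c' ≤ c` and real `p`,
`∫‖𝟙_{[-c,c]}p − 𝟙_{[-c',c']}p‖² = ∫_{[-c,c] ∖ [-c',c']} p²`. [folklore] -/
theorem dt_integral_norm_sq_indicator_sub {c c' : ℝ} (hcc : c' ≤ c) (p : ℝ → ℝ) :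
    ∫ x, ‖(((Icc (-c) c).indicator p x : ℝ) : ℂ) - (((Icc (-c') c').indicator p x : ℝ) : ℂ)‖ ^ 2 =
      ∫ x in Icc (-c) c \ Icc (-c') c', p x ^ 2 := by
  have hsub : Icc (-c') c' ⊆ Icc (-c) c := Icc_subset_Icc (by linarith) hcc
  rw [← integral_indicator (measurableSet_Icc.diff measurableSet_Icc)]
  refine integral_congr_ae (Eventually.of_forall fun x ↦ ?_)
  dsimp only
  by_cases hx' : x ∈ Icc (-c') c'
  · rw [indicator_of_mem (hsub hx'), indicator_of_mem hx', sub_self, norm_zero,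
      indicator_of_notMem (fun h ↦ h.2 hx')]
    simp
  · by_cases hx : x ∈ Icc (-c) c
    · rw [indicator_of_mem hx, indicator_of_notMem hx', indicator_of_mem (mem_sdiff_of_mem hx hx')]
      push_cast
      rw [sub_zero, Complex.norm_real, Real.norm_eq_abs, sq_abs]
    · rw [indicator_of_notMem hx, indicator_of_notMem hx', indicator_of_notMem (fun h ↦ hx h.1)]
      simp

/-- **The leaky certificate.**  Let `R = [(μ_r, q_r, ĉ_r)]` be rank-one penalty data with `μ_r ≥ 0`, `p_r = maskPoly r n a₀`,
and let `φ` be a test function with `tsupport φ ⊆ [-c, c]`, `c' ≤ c ≤ a₀`, satisfying the certificate inequality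
`β‖φ‖² ≤ E + Σ_r μ_r |Σ_k ĉ_{rk} M_k(φ)|²`.  If the trial vectors are the cut polynomials `v_r = 𝟙_{[-c',c']} p_r` and
`ν ≥ Σ_r μ_r ∫_{[-a₀,a₀]∖[-c',c']} p_r²`, then `(β − 2ν)‖φ‖² ≤ E + Σ_r 2μ_r |∫ φ v̄_r|²`. [folklore] -/
theorem dt_cert_leak (R : List (ℚ × ℕ × List ℚ)) (n : ℕ) {a₀ c c' : ℝ} (hcc : c' ≤ c) (hca : c ≤ a₀)
    (hRμ : ∀ i : Fin R.length, 0 ≤ (R.get i).1)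
    {φ : ℝ → ℂ} (hφ : IsWeilTest φ) (hφs : tsupport φ ⊆ Icc (-c) c) {β E : ℝ}
    (h23 : β * weilNorm2Sq φ ≤ E +
      (R.map fun r ↦ (r.1 : ℝ) * ‖∑ k ∈ Finset.range n, ((maskV r k : ℚ) : ℂ) * weilMoment a₀ φ k‖ ^ 2).sum)
    (v : Fin R.length → ℝ → ℂ)
    (hv : ∀ i x, v i x = (((Icc (-c') c').indicator (fun x ↦ maskPoly (R.get i) n a₀ x) x : ℝ) : ℂ))
    {ν : ℝ} (hν : ∑ i : Fin R.length, ((R.get i).1 : ℝ) *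
      ∫ x in Icc (-a₀) a₀ \ Icc (-c') c', (maskPoly (R.get i) n a₀ x) ^ 2 ≤ ν) :
    (β - 2 * ν) * ∫ x, ‖φ x‖ ^ 2 ≤
      E + ∑ i : Fin R.length, (2 * ((R.get i).1 : ℝ)) * ‖∫ x, φ x * conj (v i x)‖ ^ 2 := by
  -- the full-window vectors `u_i = 𝟙_{[-c,c]} p_i`
  set u : Fin R.length → ℝ → ℂ := fun i x ↦
    (((Icc (-c) c).indicator (fun x ↦ maskPoly (R.get i) n a₀ x) x : ℝ) : ℂ) with hu
  have hpc : ∀ i, Continuous fun x ↦ maskPoly (R.get i) n a₀ x := fun i ↦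
    (contDiff_maskPoly (R.get i) n a₀ (m := 0)).continuous
  have huM : ∀ i, MemLp (u i) 2 := fun i ↦ incs_memLp (hpc i) c
  have hvM : ∀ i, MemLp (v i) 2 := fun i ↦ by
    have e : v i = fun x ↦ (((Icc (-c') c').indicator (fun x ↦ maskPoly (R.get i) n a₀ x) x : ℝ) : ℂ) :=
      funext (hv i)
    rw [e]; exact incs_memLp (hpc i) c'
  have hφM : MemLp φ 2 := hφ.memLp_two
  have hN : weilNorm2Sq φ = ∫ x, ‖φ x‖ ^ 2 := rfl
  have hN0 : 0 ≤ ∫ x, ‖φ x‖ ^ 2 := integral_nonneg fun _ ↦ by positivity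
  -- the certificate's rank-one terms as pairings with the `u_i`
  have hsum : (R.map fun r ↦ (r.1 : ℝ) * ‖∑ k ∈ Finset.range n, ((maskV r k : ℚ) : ℂ) * weilMoment a₀ φ k‖ ^ 2).sum =
      ∑ i : Fin R.length, ((R.get i).1 : ℝ) * ‖∫ x, φ x * conj (u i x)‖ ^ 2 := by
    rw [dt_list_sum_map_eq_sum_get]
    refine Finset.sum_congr rfl fun i _ ↦ ?_
    rw [dt_rankOne_term_eq (R.get i) n a₀ hφ hφs]
  -- the leak of one term: `‖⟨φ,u_i⟩‖² ≤ 2‖⟨φ,v_i⟩‖² + 2‖φ‖² η_i²`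
  have hleak : ∀ i, ‖∫ x, φ x * conj (u i x)‖ ^ 2 ≤
      2 * ‖∫ x, φ x * conj (v i x)‖ ^ 2 +
        2 * ((∫ x, ‖φ x‖ ^ 2) * ∫ x in Icc (-a₀) a₀ \ Icc (-c') c', (maskPoly (R.get i) n a₀ x) ^ 2) := by
    intro i
    -- `⟨φ,u⟩ = ⟨φ,v⟩ + (⟨φ,u⟩ − ⟨φ,v⟩)` and Cauchy–Schwarz on the difference
    have hcs := norm_integral_mul_conj_sub_le hφM (huM i) (hvM i)
    have hdiff : ∫ x, ‖u i x - v i x‖ ^ 2 = ∫ x in Icc (-c) c \ Icc (-c') c', (maskPoly (R.get i) n a₀ x) ^ 2 := by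
      simp only [hu, hv i]
      exact dt_integral_norm_sq_indicator_sub hcc _
    have hpint : IntegrableOn (fun x ↦ (maskPoly (R.get i) n a₀ x) ^ 2) (Icc (-a₀) a₀) :=
      ((hpc i).pow 2).continuousOn.integrableOn_Icc
    have hmono : ∫ x in Icc (-c) c \ Icc (-c') c', (maskPoly (R.get i) n a₀ x) ^ 2 ≤
        ∫ x in Icc (-a₀) a₀ \ Icc (-c') c', (maskPoly (R.get i) n a₀ x) ^ 2 :=
      setIntegral_mono_set (hpint.mono_set sdiff_subset)
        (Eventually.of_forall fun x ↦ sq_nonneg _)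
        (Eventually.of_forall (sdiff_subset_sdiff_left (Icc_subset_Icc (by linarith) hca)))
    have hη0 : 0 ≤ ∫ x in Icc (-c) c \ Icc (-c') c', (maskPoly (R.get i) n a₀ x) ^ 2 :=
      setIntegral_nonneg (measurableSet_Icc.diff measurableSet_Icc) fun x _ ↦ sq_nonneg _
    set A : ℂ := ∫ x, φ x * conj (v i x) with hA
    set B : ℂ := (∫ x, φ x * conj (u i x)) - ∫ x, φ x * conj (v i x) with hB
    have hAB : ∫ x, φ x * conj (u i x) = A + B := by rw [hA, hB]; ring
    have hB2 : ‖B‖ ^ 2 ≤ (∫ x, ‖φ x‖ ^ 2) * ∫ x in Icc (-c) c \ Icc (-c') c', (maskPoly (R.get i) n a₀ x) ^ 2 := by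
      rw [← hdiff]
      have h0 : 0 ≤ ∫ x, ‖u i x - v i x‖ ^ 2 := integral_nonneg fun _ ↦ by positivity
      have h1 : ‖B‖ ≤ √(∫ x, ‖φ x‖ ^ 2) * √(∫ x, ‖u i x - v i x‖ ^ 2) := hcs
      calc ‖B‖ ^ 2 ≤ (√(∫ x, ‖φ x‖ ^ 2) * √(∫ x, ‖u i x - v i x‖ ^ 2)) ^ 2 :=
            pow_le_pow_left₀ (norm_nonneg _) h1 2
        _ = (∫ x, ‖φ x‖ ^ 2) * ∫ x, ‖u i x - v i x‖ ^ 2 := by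
            rw [mul_pow, Real.sq_sqrt hN0, Real.sq_sqrt h0]
    rw [hAB]
    -- `‖A + B‖² ≤ 2‖A‖² + 2‖B‖²` (this is `norm_add_sq_le_two` of `RHClassicalEquivalentsProofs`, inlined to keep the imports light)
    have h3 : ‖A + B‖ ^ 2 ≤ 2 * ‖A‖ ^ 2 + 2 * ‖B‖ ^ 2 := by
      have h := norm_add_le A B
      nlinarith [norm_nonneg (A + B), norm_nonneg A, norm_nonneg B, sq_nonneg (‖A‖ - ‖B‖)]
    nlinarith [mul_le_mul_of_nonneg_left hmono hN0]
  -- sum the leaks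
  have hpen : ∑ i : Fin R.length, ((R.get i).1 : ℝ) * ‖∫ x, φ x * conj (u i x)‖ ^ 2 ≤
      (∑ i : Fin R.length, (2 * ((R.get i).1 : ℝ)) * ‖∫ x, φ x * conj (v i x)‖ ^ 2) +
        2 * (∫ x, ‖φ x‖ ^ 2) * ∑ i : Fin R.length, ((R.get i).1 : ℝ) *
          ∫ x in Icc (-a₀) a₀ \ Icc (-c') c', (maskPoly (R.get i) n a₀ x) ^ 2 := by
    rw [Finset.mul_sum, ← Finset.sum_add_distrib]
    refine Finset.sum_le_sum fun i _ ↦ ?_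
    have hμ : 0 ≤ ((R.get i).1 : ℝ) := by exact_mod_cast hRμ i
    have h := mul_le_mul_of_nonneg_left (hleak i) hμ
    linarith
  have hS0 : 0 ≤ ∑ i : Fin R.length, ((R.get i).1 : ℝ) *
      ∫ x in Icc (-a₀) a₀ \ Icc (-c') c', (maskPoly (R.get i) n a₀ x) ^ 2 :=
    Finset.sum_nonneg fun i _ ↦ mul_nonneg (by exact_mod_cast hRμ i)
      (setIntegral_nonneg (measurableSet_Icc.diff measurableSet_Icc) fun x _ ↦ sq_nonneg _)
  rw [hsum, hN] at h23
  have hνN := mul_le_mul_of_nonneg_left hν hN0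
  nlinarith [hpen, hνN, hS0]

end Summit.RiemannHypothesis.RiemannHypothesis.Theorems.EvenWinsBeyondArch

end
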